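import Summits.CriticalPhenomena.SAWScalingLimit.Theses.SAWTurnDefect
import Summits.CriticalPhenomena.SAWScalingLimit.Theorems.SAWLoopFugacityFlowSimpleSubseqLimitsStubDescribable
import Summits.CriticalPhenomena.SAWScalingLimit.Theorems.ObservableToSLE.Negative.Identification
import Literature.Probability.RandomPlanarGeometry.LatticeFlowLinePassage
import HarnessLib.Audit

/-!
# Birth skeleton — crux `HexLimitsDescribable` (stmt-CriticalPhenomena-7894)

Route `SAWTurnDefect` of `CriticalPhenomena/SAWScalingLimit`, crux rank 6:

`HexLimitsDescribable := ∀ D a b, IsEmbEndpointApprox hexGraph hexCenter D a b → ∀ s μ, s → 0⁺ →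
  IsProbabilityMeasure μ → (∀ f : CurveClass ℂ →ᵇ ℝ, ∫ f ∘ curve dP^{Hex}_{s n} → ∫ f dμ) →
  ∀ φ chordal uniformizing, μ-a.e. c, IsLoewnerDescribable φ c`

(`P^{Hex}_δ = hexSAWLaw D.carrier δ (a δ) (b δ)`, the critical hexagonal SAW law): Kemppainen–Smirnov
regularity for the hexagonal SAW in OUTPUT form (KS17 Thm 1.5 (ii) / Cor 1.7–1.8), the hexagonal
twin of `SAWImaginaryGeometry.SubseqDescribable` (stmt-5943) and `SAWLaplacianWalk.LimitsDescribable`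
(stmt-4481).

## The cut (two OPEN lattice statements; the passage to the limit is PROVED here)

* `stub_ksRegularSomeApprox : HexKSRegularSomeApprox` — **KS regularity along SOME good endpoint
  approximation.** For every Dobrushin domain `D` and chordal uniformizing map `φ` there is a
  hexagonal endpoint approximation `(a⋆, b⋆)` (`IsEmbEndpointApprox`) along which the critical
  hexagonal SAW curve classes are Kemppainen–Smirnov regular through approximating chordal frames
  `(D_δ; φ_δ) → (D; φ)` — VERBATIM the Literature predicate `IsKSRegularAlongMesh`
  (`LatticeFlowLinePassage.lean`: (U1) on the compacts of the closed half-plane, (U2) at infinity,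
  `b_δ → b`, and for every `ε > 0` ONE regularity class `regularCurves (φ_δ) 𝔯` of mass `≥ 1 − ε`
  for all small `δ`). Content: Condition G2 for the critical hexagonal SAW in its lattice frames
  (OPEN — no SAW technology; sub-ballisticity arXiv:2310.17299 is the strongest unconditional input),
  KS17 Prop 3.2 / Thm 3.9 / Thm 3.10 (the tree's named fact `exists_regularity_of_conditionG2`), and
  the lattice-frame geometry (Radó/Carathéodory convergence of the frames' uniformizers,
  `ChordalUniformizerKernel.lean`). WHY THE EXISTENCE FORM (and not "along every approximation", the
  typing of the `δℤ²` twin `SAWKSRegularAlong` of crux stmt-4982): `IsEmbEndpointApprox` admits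
  lattice endpoints in the INTERIOR of `Ω_δ` at distance `h(δ) ≫ δ` from `∂D` (only `δ·a_δ → a` is
  asked); a member of `regularCurves (φ_δ) 𝔯` starts AT the frame's marked prime end and runs inside
  the (Jordan) frame, which is impossible as soon as the walk winds once about its own starting point
  — an event of probability bounded away from `0` (heuristically `→ 1`) across the scales
  `δ ≪ r ≪ h(δ)`. The limit is insensitive to this (the scales shrink to `a`), the event form at
  finite mesh is not; so the event form is asserted for ONE approximation (boundary vertices of
  `Ω_δ`, where exact frames exist surely) and the transfer to arbitrary approximations is the second
  stub.
* `stub_endpointInsensitive : HexEndpointInsensitive` — **endpoint insensitivity of the critical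
  hexagonal SAW law** (test-function form): for two hexagonal endpoint approximations `(a, b)`,
  `(a', b')` of the same Dobrushin domain and every bounded continuous `f` on `CurveClass ℂ`,
  `∫ f ∘ curve dP^{Hex}_δ(a_δ, b_δ) − ∫ f ∘ curve dP^{Hex}_δ(a'_δ, b'_δ) → 0` as `δ → 0⁺`. The
  hexagonal twin, in the weaker test-function form, of the `δℤ²` crux
  `SAWCircleScreening.EndpointCoupling` (stmt-CriticalPhenomena-5465, Lévy–Prokhorov form; "known
  only as a consequence of the conjunct … mesoscopic starts"). OPEN; a consequence of the hexagonal
  scaling-limit conjecture (DCS Conjecture 1 as typed), strictly weaker than it.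

## Composition (PROVED, no `sorry`): `HexLimitsDescribable_of`

Given `(D; a, b)`, a mesh sequence `s → 0⁺`, a probability weak limit `μ` of the laws along `s` and a
chordal uniformizing `φ`: (1) `stub_ksRegularSomeApprox` gives a good approximation `(a⋆, b⋆)` with
frames `(D_δ, φ_δ)`; (2) by `stub_endpointInsensitive` the laws of `(a⋆, b⋆)` along `s` have the SAME
weak limit `μ`; (3) they are probability measures for `n ≥ N₀`
(`ObservableToSLE.Negative.eventually_isProbabilityMeasure_hexSAWLaw`, landed); (4) along the honest
tail `n ↦ s (n + N₀)` the mesh-indexed clauses of `IsKSRegularAlongMesh` are read off as the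
sequence-indexed hypotheses (U1), (U2), `b_n → b` and EVENTUAL regularity; (5) the landed eventual form
of KS Thm 1.5 (ii) for random curve classes in varying frames,
`SimpleSubseqLimits.CapacityClock.Describable.ae_isLoewnerDescribable_of_eventually_regular`
(`Theorems/SAWLoopFugacityFlowSimpleSubseqLimitsStubDescribable.lean`), concludes
`μ`-a.e. `IsLoewnerDescribable φ`. The theorem concludes `Theses.SAWTurnDefect.HexLimitsDescribable`
BY NAME; its hypotheses are keyed by the registered stub names (`Registered.stub_*` aliases).

## Disproof used

`Cruxes/HexLimitsDescribable/` had no workfiles at registration (no `Disproof.lean`, no Negative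
lemmas): none relevant. Negatives index of the summit: the refuted all-`δ` tightness stmt-0772 is not
touched (every clause here is eventual in `δ`).

## Audit record (planner skeleton-register, 2026-08-17; probe files and raw outputs in `Lines/birth.md`)

* `lean check --json`: rc 0, errors [], sorries = 2 = the two `stub_*` (lines of `stub_ksRegularSomeApprox`,
  `stub_endpointInsensitive`; no other `sorry`); `#print axioms HexLimitsDescribable_of` =
  [propext, Classical.choice, Quot.sound].
* `#h21_check_skeleton "stmt-CriticalPhenomena-7894" …SAWTurnDefect.HexLimitsDescribable
  stub_ksRegularSomeApprox stub_endpointInsensitive`: ok = true, codes = [], theorem =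
  `HexLimitsDescribable_of`, sorries = the two stubs.
* BC3 probes (`first | exact? | simpa [S] | (unfold S; simpa) | aesop`, plus the form with the
  hypothesis introduced and all definitions unfolded, `first | exact? | simpa using h | aesop`; probe
  files import only the route file and `LatticeFlowLinePassage`, the stub restated verbatim, no sorried
  declaration in scope): `HexKSRegularSomeApprox → HexLimitsDescribable` FAIL 2/2, `→ SAWScalingLimit`
  FAIL 2/2; `HexEndpointInsensitive → HexLimitsDescribable` FAIL 2/2, `→ SAWScalingLimit` FAIL 2/2
  (8/8 "unsolved goals" + "aesop: failed to prove the goal after exhaustive search"). Converse records: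
  `HexLimitsDescribable → stub` FAIL ×2, `SAWScalingLimit → stub` FAIL ×2 (no landed pin either way; the
  stubs are hexagonal-lattice statements, the conjunct is on `δℤ²`).
-/

noncomputable section

open MeasureTheory Filter Topology Set Metric Function
open Literature.Probability.RandomPlanarGeometry Literature.Probability.RandomPlanarGeometry.SAW
open Literature.Probability.LatticeModels
open UpperHalfPlane (upperHalfPlaneSet)
open scoped ENNReal NNReal BoundedContinuousFunction unitInterval

namespace Summit.CriticalPhenomena.SAWScalingLimit.Cruxes.HexLimitsDescribable.Birth

open Summit.CriticalPhenomena.SAWScalingLimit.Theorems.SimpleSubseqLimits.CapacityClock.Describable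
  (ae_isLoewnerDescribable_of_eventually_regular)
open Summit.CriticalPhenomena.SAWScalingLimit.Theorems.ObservableToSLE.Negative
  (eventually_isProbabilityMeasure_hexSAWLaw)

/-! ### The two stub statements -/

/-- **KS regularity of the critical hexagonal SAW along SOME endpoint approximation** (event form,
approximating chordal frames, mesh-indexed — the Literature predicate `IsKSRegularAlongMesh`
verbatim): for every Dobrushin domain `D` and chordal uniformizing map `φ` of `(D; a, b)` there are
hexagonal lattice endpoints `a⋆ δ, b⋆ δ` approximating `a, b` (`IsEmbEndpointApprox`) such that the
curve classes of the critical hexagonal SAW of `(Ω_δ; a⋆ δ, b⋆ δ)` under `hexSAWLaw` are KS-regular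
towards `(D, φ)`. [cite: KemppainenSmirnov2017, Thm. 1.5, Cor. 1.7–1.8, Prop. 3.2 and §3.5] -/
def HexKSRegularSomeApprox : Prop :=
  ∀ (D : Literature.Probability.RandomPlanarGeometry.DobrushinDomain)
      (φ : Literature.Probability.RandomPlanarGeometry.ConformalEquiv UpperHalfPlane.upperHalfPlaneSet
        D.carrier), D.IsChordalUniformizing φ →
      ∃ a b : ℝ → Literature.Probability.LatticeModels.HexVertex,
        Literature.Probability.RandomPlanarGeometry.SAW.IsEmbEndpointApprox
            Literature.Probability.LatticeModels.hexGraph Literature.Probability.LatticeModels.hexCenter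
            D a b ∧
          Literature.Probability.RandomPlanarGeometry.IsKSRegularAlongMesh D φ
            (fun δ (γ : Literature.Probability.RandomPlanarGeometry.SAW.HexDomainSAW D.carrier δ (a δ)
              (b δ)) => γ.curve)
            (fun δ => Literature.Probability.RandomPlanarGeometry.SAW.hexSAWLaw D.carrier δ (a δ) (b δ))

/-- **Endpoint insensitivity of the critical hexagonal SAW law** (test-function form): the curve
laws along two hexagonal endpoint approximations of the same Dobrushin domain have asymptotically
equal integrals against every bounded continuous test function on `CurveClass ℂ`. Hexagonal twin
(weak form) of `SAWCircleScreening.EndpointCoupling` (stmt-CriticalPhenomena-5465).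
[cite: DuminilCopinSmirnov2012, §4 Conjecture 1] [cite: KennedyLawler2013, §1] -/
def HexEndpointInsensitive : Prop :=
  ∀ (D : Literature.Probability.RandomPlanarGeometry.DobrushinDomain)
      (a b a' b' : ℝ → Literature.Probability.LatticeModels.HexVertex),
      Literature.Probability.RandomPlanarGeometry.SAW.IsEmbEndpointApprox
          Literature.Probability.LatticeModels.hexGraph Literature.Probability.LatticeModels.hexCenter
          D a b →
        Literature.Probability.RandomPlanarGeometry.SAW.IsEmbEndpointApprox
            Literature.Probability.LatticeModels.hexGraph Literature.Probability.LatticeModels.hexCenter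
            D a' b' →
          ∀ f : BoundedContinuousFunction (Literature.Probability.RandomPlanarGeometry.CurveClass ℂ) ℝ,
            Filter.Tendsto
              (fun δ : ℝ =>
                (∫ γ, f γ.curve ∂(Literature.Probability.RandomPlanarGeometry.SAW.hexSAWLaw D.carrier δ
                    (a δ) (b δ))) -
                  ∫ γ, f γ.curve ∂(Literature.Probability.RandomPlanarGeometry.SAW.hexSAWLaw D.carrier δ
                    (a' δ) (b' δ)))
              (nhdsWithin (0 : ℝ) (Set.Ioi 0)) (nhds 0)

/-! ### The registered stubs (the only `sorry`s of this file) -/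

/-- **STUB 1 — KS REGULARITY ALONG SOME GOOD APPROXIMATION** (OPEN: Condition G2 for the critical
hexagonal SAW in its lattice frames + KS17 §3 + frame geometry). -/
theorem stub_ksRegularSomeApprox :
    ∀ (D : Literature.Probability.RandomPlanarGeometry.DobrushinDomain)
      (φ : Literature.Probability.RandomPlanarGeometry.ConformalEquiv UpperHalfPlane.upperHalfPlaneSet
        D.carrier), D.IsChordalUniformizing φ →
      ∃ a b : ℝ → Literature.Probability.LatticeModels.HexVertex,
        Literature.Probability.RandomPlanarGeometry.SAW.IsEmbEndpointApprox
            Literature.Probability.LatticeModels.hexGraph Literature.Probability.LatticeModels.hexCenter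
            D a b ∧
          Literature.Probability.RandomPlanarGeometry.IsKSRegularAlongMesh D φ
            (fun δ (γ : Literature.Probability.RandomPlanarGeometry.SAW.HexDomainSAW D.carrier δ (a δ)
              (b δ)) => γ.curve)
            (fun δ => Literature.Probability.RandomPlanarGeometry.SAW.hexSAWLaw D.carrier δ (a δ) (b δ)) := by
  sorry

/-- **STUB 2 — ENDPOINT INSENSITIVITY** (OPEN: mixing of the critical hexagonal SAW at its
endpoints; hexagonal twin of stmt-CriticalPhenomena-5465). -/
theorem stub_endpointInsensitive :
    ∀ (D : Literature.Probability.RandomPlanarGeometry.DobrushinDomain)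
      (a b a' b' : ℝ → Literature.Probability.LatticeModels.HexVertex),
      Literature.Probability.RandomPlanarGeometry.SAW.IsEmbEndpointApprox
          Literature.Probability.LatticeModels.hexGraph Literature.Probability.LatticeModels.hexCenter
          D a b →
        Literature.Probability.RandomPlanarGeometry.SAW.IsEmbEndpointApprox
            Literature.Probability.LatticeModels.hexGraph Literature.Probability.LatticeModels.hexCenter
            D a' b' →
          ∀ f : BoundedContinuousFunction (Literature.Probability.RandomPlanarGeometry.CurveClass ℂ) ℝ,
            Filter.Tendsto
              (fun δ : ℝ =>
                (∫ γ, f γ.curve ∂(Literature.Probability.RandomPlanarGeometry.SAW.hexSAWLaw D.carrier δ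
                    (a δ) (b δ))) -
                  ∫ γ, f γ.curve ∂(Literature.Probability.RandomPlanarGeometry.SAW.hexSAWLaw D.carrier δ
                    (a' δ) (b' δ)))
              (nhdsWithin (0 : ℝ) (Set.Ioi 0)) (nhds 0) := by
  sorry

/-! ### Name-keyed aliases (the skeleton audit admits a hypothesis of the composition only if its
head constant is a registered obligation or is named like a declared stub) -/
namespace Registered

/-- Alias of `HexKSRegularSomeApprox` keyed by the registered stub name. -/
abbrev stub_ksRegularSomeApprox : Prop := HexKSRegularSomeApprox
/-- Alias of `HexEndpointInsensitive` keyed by the registered stub name. -/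
abbrev stub_endpointInsensitive : Prop := HexEndpointInsensitive

end Registered

/-! ### Composition (PROVED): stubs ⇒ the crux, by name -/

/-- **The composition.** `stub_ksRegularSomeApprox → stub_endpointInsensitive → HexLimitsDescribable`
(stmt-CriticalPhenomena-7894, concluded BY NAME): transfer of the weak limit to the good approximation
by endpoint insensitivity, eventual honesty of its laws, tail shift, extraction of the sequence-indexed
KS hypotheses from `IsKSRegularAlongMesh`, and the landed eventual form of KS Thm 1.5 (ii) in varying
frames. No other route item is used. -/
theorem HexLimitsDescribable_of (hA : Registered.stub_ksRegularSomeApprox)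
    (hB : Registered.stub_endpointInsensitive) :
    Summit.CriticalPhenomena.SAWScalingLimit.Theses.SAWTurnDefect.HexLimitsDescribable := by
  intro D a b hab s μ hs hμ hw φ hφ
  haveI := hμ
  -- (1) a good approximation, KS-regular towards (D, φ)
  obtain ⟨a', b', hab', Dd, φd, hch, hU1, hU2, hb1, hreg⟩ := hA D φ hφ
  -- (2) its laws along `s` have the same weak limit `μ`
  have hw' : ∀ f : CurveClass ℂ →ᵇ ℝ,
      Tendsto (fun n => ∫ γ, f γ.curve ∂(hexSAWLaw D.carrier (s n) (a' (s n)) (b' (s n))))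
        atTop (𝓝 (∫ x, f x ∂μ)) := by
    intro f
    have h := (hw f).sub ((hB D a b a' b' hab hab' f).comp hs)
    simp only [Function.comp_def, sub_sub_cancel, sub_zero] at h
    exact h
  -- (3) honesty along a tail of the sequence
  obtain ⟨N₀, hN₀⟩ := eventually_atTop.1
    (hs.eventually (eventually_isProbabilityMeasure_hexSAWLaw hab'))
  have hT := tendsto_add_atTop_nat N₀
  have hs' : Tendsto (fun n => s (n + N₀)) atTop (𝓝[>] (0 : ℝ)) := hs.comp hT
  haveI hP : ∀ n, IsProbabilityMeasure
      (hexSAWLaw D.carrier (s (n + N₀)) (a' (s (n + N₀))) (b' (s (n + N₀)))) :=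
    fun n => hN₀ (n + N₀) (Nat.le_add_left N₀ n)
  -- (4)+(5) the sequence-indexed KS hypotheses along the tail, and the landed eventual passage
  refine ae_isLoewnerDescribable_of_eventually_regular
    (Ds := fun n => Dd (s (n + N₀))) (φs := fun n => φd (s (n + N₀)))
    (Ω := fun n => HexDomainSAW D.carrier (s (n + N₀)) (a' (s (n + N₀))) (b' (s (n + N₀))))
    (Y := fun n γ => γ.curve)
    (P := fun n => hexSAWLaw D.carrier (s (n + N₀)) (a' (s (n + N₀))) (b' (s (n + N₀))))
    hφ (fun n => hch _) (fun R => ?_) (fun ε hε => ?_) (hb1.comp hs')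
    (fun n => (EmbDomainSAW.measurable_of_top _).aemeasurable) (fun f => (hw' f).comp hT)
    (fun ε hε => ?_)
  · -- (U1) along the tail
    have h := hU1 R
    rw [Metric.tendstoUniformlyOn_iff] at h ⊢
    exact fun ε hε => hs'.eventually (h ε hε)
  · -- (U2) along the tail
    obtain ⟨r, hr⟩ := hU2 ε hε
    exact ⟨r, (hs'.eventually hr).mono fun n hn z hz hrz => hn z hz hrz⟩
  · -- eventual regularity along the tail
    obtain ⟨𝔯, h𝔯⟩ := hreg ε hε
    exact ⟨𝔯, hs'.eventually h𝔯⟩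

/-- Wiring check: the registered stubs feed `HexLimitsDescribable_of` as stated. -/
example : Summit.CriticalPhenomena.SAWScalingLimit.Theses.SAWTurnDefect.HexLimitsDescribable :=
  HexLimitsDescribable_of stub_ksRegularSomeApprox stub_endpointInsensitive


end Summit.CriticalPhenomena.SAWScalingLimit.Cruxes.HexLimitsDescribable.Birth

end
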